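import Summits.CriticalPhenomena.PercolationContinuityZ3.Theorems.Transplant.SkeletonFrmQuasiCustomersHolds
import Summits.CriticalPhenomena.PercolationContinuityZ3.Theorems.Transplant.AutCocompactGrowth
import Literature.GroupTheory.Nilpotent.PolynomialGrowthVirtuallyNilpotent
import HarnessLib

/-!
# Φ2 for FREE COCOMPACT NILPOTENT ACTIONS with NO growth hypothesis: every connected locally finite graph with `p_c < 1` carrying a free action with
# finitely many orbits by automorphisms of a NILPOTENT group has `θ_x(p_c) = 0` at every vertex (rung-Q node + Wolf 1968)

builds on p205010 (kernel theorem, internal audit signed; external expert review pending).  Lane `prim-bschramm`, seat `prim-bschramm-gen-1` gen 6 (GEN pen), lead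
g24's GO §P (2026-08-27 #7215).  Helper file (`--supports stmt-CriticalPhenomena-4575 --as helper`); PROOFS ONLY; NOTHING is claimed about any open node and no
'closed' wording is used — the words are the lead's.

THE POINT.  gen-5 g2's customers file «SkeletonFrmQuasiCustomersHolds» (p554455) carries `AutCyl.conj4_of_free_nilpotent_holds (d) (X) (hc) (hpoly) (K) …` — the
free-cocompact-nilpotent-action theorem of «AutCylinderNilpotent» §3 with its node hypothesis discharged by the rung-Q node, but still WITH the growth binder
`hpoly : ∃ C, ∀ x n, |B_X(x,n)| ≤ C (n+1)^d`.  That binder is REDUNDANT: a cocompact action transfers growth from the group to the graph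
(«AutCocompactGrowth», `AutChart.exists_polynomialGrowth_of_cocompact`: `|B_X(x,n)| ≤ |reps|·|B_{Cay(K;S)}(1,n)|` for a finite `S ⊆ K`), and a NILPOTENT
group has polynomially growing Cayley balls for EVERY finite `S` (Wolf 1968 Thm. 3.2, p3 g31's Literature reproduction «PolynomialGrowthVirtuallyNilpotent» §2
`ballVolume_mulCayley_le_polynomial_of_isNilpotent`).  Hence **`AutCyl.conj4_of_free_nilpotent`**: the same conclusion with the hypotheses connected, locally finite,
free, finitely many orbits (a finite `reps` meeting every orbit), by automorphisms, `K` nilpotent, `p_c < 1` — and nothing else.  `K` is NOT assumed finitely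
generated (for a free cocompact action on a connected locally finite graph it is; the proof does not need it: Wolf's bound is used for the finite set `S` of
sections of neighbours of representatives, inside the nilpotent group `K`).
[cite: BenjaminiSchramm1996, Conj. 4; §2 (almost transitive graphs)] [cite: WolfGrowth1968, Thm. 3.2] [cite: Woess2000, Prop. 3.9, Lemma 3.13]
-/

noncomputable section

namespace Summit.CriticalPhenomena.PercolationContinuityZ3.Theorems.Transplant

open SimpleGraph Literature.Barriers.CriticalPhenomena Literature.Probability.LatticeModels Literature.Probability.Percolation
open scoped Classical

namespace AutCyl

/-- **UNCONDITIONAL IN THE TREE, NO GROWTH HYPOTHESIS, NO NAMED FACT — Φ2 for free cocompact NILPOTENT actions**: on every connected locally finite graph carrying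
a FREE action by automorphisms of a NILPOTENT group `K` with finitely many orbits (`reps` a finite set meeting every orbit), `p_c < 1 ⟹ θ_x(p_c) = 0` at every
vertex `x`.  (= `conj4_of_free_nilpotent_holds` with its binder `hpoly` discharged by the cocompact growth transfer and Wolf's theorem; the growth degree fed to the
induction of «AutCylinderNilpotent» §3 is Wolf's exponent for the finite set of neighbour sections.)
[cite: BenjaminiSchramm1996, Conj. 4; §2] [cite: WolfGrowth1968, Thm. 3.2] [cite: Woess2000, Prop. 3.9, Lemma 3.13] -/
theorem conj4_of_free_nilpotent {W : Type} (X : SimpleGraph W) [X.LocallyFinite] (hc : X.Connected)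
    (K : Type) [Group K] [Group.IsNilpotent K] [MulAction K W] (hact : IsActionByAut X K) (hfree : ∀ (k : K) (w : W), k • w = w → k = 1)
    (reps : Finset W) (hcover : ∀ w : W, ∃ k : K, ∃ r ∈ reps, k • r = w) (x : W) (hpc : criticalProb X x < 1) :
    theta X x (criticalProbIOf X x) = 0 := by
  obtain ⟨C, D, hCD⟩ := AutChart.exists_polynomialGrowth_of_cocompact hact reps hcover fun S => by
    obtain ⟨C, D, -, h⟩ := Literature.GroupTheory.Nilpotent.ballVolume_mulCayley_le_polynomial_of_isNilpotent S
    exact ⟨C, D, fun n => h 1 n⟩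
  exact conj4_of_free_nilpotent_holds D X hc ⟨C, hCD⟩ K hact hfree reps hcover x hpc

end AutCyl

end Summit.CriticalPhenomena.PercolationContinuityZ3.Theorems.Transplant

end
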